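import Mathlib
import Summits.NavierStokesRegularity.NavierStokesRegularity.Theorems.EulerZoomLiouvillePowerGaugeEulerLiouvilleSwirlfreeLedgerFlow
import Literature.Analysis.FluidPDE.AxisymmetricVorticityTransport
import Literature.Analysis.FluidPDE.AxisymNoSwirlVorticity
import Literature.Analysis.FluidPDE.AxisymVorticityAlgebra
import Literature.Analysis.FluidPDE.Wei2016Lemma23
import Literature.Analysis.FluidPDE.SqIntegralBalance
import HarnessLib

/-!
# Crux `EulerZoomLiouville.PowerGaugeEulerLiouville` (stmt-NavierStokesRegularity-19832), line `swirlfree-ledger`, stub S2 — part 2: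
# MATERIAL CONSERVATION OF `ω_θ / r` AND THE MONOTONE AXIS LEDGER (`stub_materialConfinement`, signature unfolded)

Route №10 `EulerZoomLiouville` (NavierStokesRegularity), crux E.  Line `swirlfree-ledger` (ideator ns-idea-11;
`Cruxes/PowerGaugeEulerLiouville/Lines/swirlfree_ledger.lean`), registered stub `stub_materialConfinement` (S2, the hardest provable
stub), proved here with its signature UNFOLDED in the tree's vocabulary (the line's `IsSwirlFreeDrifting`, `LedgerMonotone`,
`axisLedger v x = ‖curl v x‖ / cylRadius x` are `def`s of the Cruxes file; the statement below is their `δ`-unfolding, so the skeleton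
fills the stub by `exact`).

THE STATEMENT.  For a classical Euler solution `(u, p)` on `(−∞,0) × ℝ³` whose slices are axisymmetric WITHOUT swirl and whose velocity
decays into the past at a sub-parabolic rate, `‖u(τ, x)‖ ≤ M (−τ)^{−κ}` with `κ > 1/2`, and every `q > 0`: for all `t₀ < 0`, `R₀ > 0`
there is `A₀ > 0` such that for `a ≥ A₀` and `t₁ ∈ (−a², t₀)`,
`∫_{B(R₀)} (|curl u(t₀)|/r)^q ≤ ∫_{B(a)} (|curl u(t₁)|/r)^q`.

THE PROOF (Majda–Bertozzi §2.3.3, (2.58)–(2.59): "`ξ = ω^θ/r` is conserved along particle trajectories"; Ukhovskii–Yudovich 1968),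
carried out on the LOCALISED flow of part 1 (`…SwirlfreeLedgerFlow`): with `κ₀ = min κ ¾ < 1` the speed is `≤ M₀(−s)^{−κ₀}` before `t₀`,
so the backward displacement over `[t₁, t₀] ⊆ (−a², t₀]` is `≤ K a^{2−2κ₀}` (`K = M₀/(1−κ₀)`), and for
`a ≥ A₀ = max(2R₀, (2K+1)^{1/(2κ₀−1)}, 1)` the parcels of `B(R₀)` stay in `B(R_c)`, `R_c = R₀ + K a^{2−2κ₀} ≤ a`; the cut-off field
`w = χ u` (`χ = 1` on `B̄(R_c+1)`) has a genuine flow `φ` which, on these parcels, IS the Euler flow: (i) off the symmetry axis the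
material quantity `θ = ⟪Jx, ω⟫/r² = ω_θ/r` satisfies `∂ₜθ + u·∇θ = r⁻⁴∂_z(Γ²) = 0` (the tree's `chenHou_omegaTilde_transport` with
`Γ = swirl u ≡ 0`), so `θ` is constant along every confined off-axis trajectory (local chain rule; off-axis points stay off the axis,
part 1); (ii) `|curl u|/r = |θ|` off the axis (`ω = f·Jx`, `curl_eq_hadamardQuotFst_smul_rotGen`); (iii) the axis is null, `det Dφ = 1`
on `B(R₀)` (divergence zero along confined trajectories), and `φ(B(R₀)) ⊆ B(a)`; the change of variables of part 1 concludes.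

* `hasDerivAt_uncurry_comp` — local chain rule along a curve;
* `div_cylRadius_eq_abs_omegaTilde` — `|curl v|/r = |⟪Jx, curl v⟫/r²|` off the axis (axisymmetric swirl-free `C²` field);
* `differentiableAt_omegaTilde`, `omegaTilde_transport` — regularity and the transport identity of `θ` off the axis;
* `omegaTilde_evolutionMap_eq` — `θ` is conserved along confined off-axis trajectories of the cut-off flow;
* **`materialConfinement_of_swirlFreeDrifting`** — the stub signature, unfolded.

WHAT THIS IS NOT: not NS, not the crux — a helper `--supports` stmt-19832 on the line `swirlfree-ledger`; no summit statement is proved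
here.  [cite: MajdaBertozziCUP2002, §2.3.3 (2.58)–(2.59), §1.3 Prop. 1.4; UkhovskiiYudovich 1968 (the conserved quantity ω_θ/r)]
-/

noncomputable section

-- flat `Theorems/<Route><Decl>…` files of one crux share the namespace of the crux (tree convention)
set_option linter.dupNamespace false

open MeasureTheory Set Filter Topology Metric Function
open scoped NNReal ENNReal ContDiff RealInnerProductSpace

namespace Summit.NavierStokesRegularity.NavierStokesRegularity.Theorems.PowerGaugeEulerLiouville.SwirlfreeLedger

open Literature.Analysis Literature.Analysis.FluidPDE

variable {u : ℝ → EuclideanSpace ℝ (Fin 3) → EuclideanSpace ℝ (Fin 3)} {p : ℝ → EuclideanSpace ℝ (Fin 3) → ℝ} {S : Set ℝ}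

/-! ### A local chain rule -/

/-- **Chain rule along a curve, local form**: if `(s, y) ↦ f s y` is differentiable at `(s, γ s)` and `γ` has velocity `w` at `s`,
then `r ↦ f r (γ r)` has derivative `∂ₜf(s, γ s) + Df(s)(γ s)[w]` at `s` (the partial derivatives being those of the total
derivative along `(1,0)` and `(0,·)`). [folklore] -/
theorem hasDerivAt_uncurry_comp {f : ℝ → EuclideanSpace ℝ (Fin 3) → ℝ} {γ : ℝ → EuclideanSpace ℝ (Fin 3)} {s : ℝ}
    {w : EuclideanSpace ℝ (Fin 3)} (hf : DifferentiableAt ℝ (uncurry f) (s, γ s)) (hγ : HasDerivAt γ w s) :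
    HasDerivAt (fun r => f r (γ r)) (deriv (fun r => f r (γ s)) s + fderiv ℝ (f s) (γ s) w) s := by
  set L : ℝ × EuclideanSpace ℝ (Fin 3) →L[ℝ] ℝ := fderiv ℝ (uncurry f) (s, γ s) with hL
  have hcurve : HasDerivAt (fun r : ℝ => ((r, γ r) : ℝ × EuclideanSpace ℝ (Fin 3))) ((1 : ℝ), w) s :=
    (hasDerivAt_id s).prodMk hγ
  have hcomp : HasDerivAt (uncurry f ∘ fun r : ℝ => ((r, γ r) : ℝ × EuclideanSpace ℝ (Fin 3))) (L ((1 : ℝ), w)) s :=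
    hf.hasFDerivAt.comp_hasDerivAt s hcurve
  have h1 : HasDerivAt (fun r : ℝ => ((r, γ s) : ℝ × EuclideanSpace ℝ (Fin 3)))
      ((1 : ℝ), (0 : EuclideanSpace ℝ (Fin 3))) s :=
    (hasDerivAt_id s).prodMk (hasDerivAt_const s (γ s))
  have ht : HasDerivAt (uncurry f ∘ fun r : ℝ => ((r, γ s) : ℝ × EuclideanSpace ℝ (Fin 3)))
      (L ((1 : ℝ), (0 : EuclideanSpace ℝ (Fin 3)))) s :=
    hf.hasFDerivAt.comp_hasDerivAt s h1
  have ht' : deriv (fun r => f r (γ s)) s = L ((1 : ℝ), (0 : EuclideanSpace ℝ (Fin 3))) := ht.deriv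
  have hx : HasFDerivAt (uncurry f ∘ fun y : EuclideanSpace ℝ (Fin 3) => ((s, y) : ℝ × EuclideanSpace ℝ (Fin 3)))
      (L.comp (ContinuousLinearMap.inr ℝ ℝ (EuclideanSpace ℝ (Fin 3)))) (γ s) :=
    hf.hasFDerivAt.comp (γ s) (hasFDerivAt_prodMk_right s (γ s))
  have hx' : fderiv ℝ (f s) (γ s) = L.comp (ContinuousLinearMap.inr ℝ ℝ (EuclideanSpace ℝ (Fin 3))) := hx.fderiv
  have hfin : HasDerivAt (fun r => f r (γ r)) (L ((1 : ℝ), w)) s := hcomp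
  refine hfin.congr_deriv ?_
  have hsplit : ((1 : ℝ), w) = ((1 : ℝ), (0 : EuclideanSpace ℝ (Fin 3))) + ((0 : ℝ), w) := by
    rw [Prod.mk_add_mk, add_zero, zero_add]
  rw [hsplit, map_add, ht', hx']
  rfl

/-! ### The material quantity `θ = ω_θ / r` -/

/-- **The ledger density is `|θ|` off the axis**: for an axisymmetric swirl-free `C²` field, `curl v = f · Jx` (`Jx = (−x₁, x₀, 0)`,
`‖Jx‖ = r`), hence `|curl v x| / r(x) = |⟪Jx, curl v x⟫ / r(x)²|` wherever `r(x) ≠ 0`. [cite: KochNadirashviliSereginSverak2009, §5 Remark 5.1] -/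
theorem div_cylRadius_eq_abs_omegaTilde {v : EuclideanSpace ℝ (Fin 3) → EuclideanSpace ℝ (Fin 3)}
    (hax : IsAxisymmetric v) (hsw : HasNoSwirl v) (hv : ContDiff ℝ 2 v) {y : EuclideanSpace ℝ (Fin 3)} (hy : cylRadius y ≠ 0) :
    ‖curl v y‖ / cylRadius y = |swirl (curl v) y * (cylRadius y ^ 2)⁻¹| := by
  have hc := curl_eq_hadamardQuotFst_smul_rotGen hax hsw hv y
  set f : ℝ := hadamardQuotFst (fun y => curl v y 1) y with hf
  have hnorm : ‖rotGen y‖ = cylRadius y := by rw [norm_rotGen]; rfl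
  have hsw' : swirl (curl v) y = f * cylRadius y ^ 2 := by
    rw [swirl_eq_inner_rotGen]
    simp only []
    rw [hc, inner_smul_right, real_inner_self_eq_norm_sq, hnorm]
  have hr2 : cylRadius y ^ 2 ≠ 0 := pow_ne_zero 2 hy
  rw [hsw', mul_inv_cancel_right₀ hr2, hc, norm_smul, hnorm, Real.norm_eq_abs, mul_div_cancel_right₀ _ hy]

/-- **`θ` is differentiable in space–time off the axis**: for a velocity jointly smooth on an open set of times `S`, the function
`(s, y) ↦ ⟪Jy, curl u(s,y)⟫ / r(y)²` is differentiable at every `(s, y)` with `s ∈ S`, `r(y) ≠ 0` (the vorticity is jointly smooth;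
`⟪Jy, ·⟫` is bilinear; `r(y)² = y₀² + y₁² ≠ 0`). [folklore] -/
theorem differentiableAt_omegaTilde (hω : IsSmoothSpaceTimeOn S (vorticity u)) (hSo : IsOpen S) {s : ℝ} (hs : s ∈ S)
    {y : EuclideanSpace ℝ (Fin 3)} (hy : cylRadius y ≠ 0) :
    DifferentiableAt ℝ (uncurry fun (s : ℝ) (y : EuclideanSpace ℝ (Fin 3)) =>
      swirl (vorticity u s) y * (cylRadius y ^ 2)⁻¹) (s, y) := by
  have hmem : S ×ˢ (univ : Set (EuclideanSpace ℝ (Fin 3))) ∈ 𝓝 (s, y) :=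
    (hSo.prod isOpen_univ).mem_nhds ⟨hs, mem_univ _⟩
  have hωd : DifferentiableAt ℝ (uncurry (vorticity u)) (s, y) :=
    (hω.differentiableOn (by simp)).differentiableAt hmem
  have hπ : ∀ i : Fin 3, Differentiable ℝ fun x : EuclideanSpace ℝ (Fin 3) => x i := fun i =>
    (contDiff_piLp_apply (𝕜 := ℝ) (p := 2) (n := 1) (i := i)).differentiable one_ne_zero
  have hωi : ∀ i : Fin 3, DifferentiableAt ℝ (fun q : ℝ × EuclideanSpace ℝ (Fin 3) => uncurry (vorticity u) q i) (s, y) :=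
    fun i => ((hπ i).differentiableAt).comp (s, y) hωd
  have hyi : ∀ i : Fin 3, DifferentiableAt ℝ (fun q : ℝ × EuclideanSpace ℝ (Fin 3) => q.2 i) (s, y) :=
    fun i => ((hπ i).comp differentiable_snd).differentiableAt
  have e : (uncurry fun (s : ℝ) (y : EuclideanSpace ℝ (Fin 3)) => swirl (vorticity u s) y * (cylRadius y ^ 2)⁻¹) =
      fun q : ℝ × EuclideanSpace ℝ (Fin 3) =>
        (q.2 0 * uncurry (vorticity u) q 1 - q.2 1 * uncurry (vorticity u) q 0) * (q.2 0 ^ 2 + q.2 1 ^ 2)⁻¹ := by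
    funext q
    simp only [uncurry, swirl, cylRadius_sq]
  rw [e]
  have hne : y 0 ^ 2 + y 1 ^ 2 ≠ 0 := by rw [← cylRadius_sq]; exact pow_ne_zero 2 hy
  refine (((hyi 0).mul (hωi 1)).sub ((hyi 1).mul (hωi 0))).mul ?_
  exact (((hyi 0).pow 2).add ((hyi 1).pow 2)).inv hne

/-- **The transport identity of `θ` off the axis**: for a classical Euler solution with axisymmetric swirl-free slices on an open set
of times `S`, at `s ∈ S` and `r(y) ≠ 0`, `∂ₜθ(s, y) + Dθ(s)(y)[u(s, y)] = 0` — the tree's `chenHou_omegaTilde_transport`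
(`∂ₜ(ω^θ/r) + (u·∇)(ω^θ/r) = r⁻⁴ ∂_z(Γ²)`) with `Γ = swirl u ≡ 0`. [cite: MajdaBertozziCUP2002, §2.3.3 (2.58)] -/
theorem omegaTilde_transport (hcl : IsClassicalEulerSolutionOn S 0 u p) (hSo : IsOpen S)
    (hax : ∀ s ∈ S, IsAxisymmetric (u s)) (hsw : ∀ s ∈ S, HasNoSwirl (u s)) {s : ℝ} (hs : s ∈ S)
    {y : EuclideanSpace ℝ (Fin 3)} (hy : cylRadius y ≠ 0) :
    deriv (fun r => swirl (vorticity u r) y * (cylRadius y ^ 2)⁻¹) s +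
      fderiv ℝ (fun z => swirl (vorticity u s) z * (cylRadius z ^ 2)⁻¹) y (u s y) = 0 := by
  have hclo : S ⊆ closure (interior S) := by rw [hSo.interior_eq]; exact subset_closure
  have h := hcl.chenHou_omegaTilde_transport hSo.uniqueDiffOn hclo hax hs hy
  have hzero : partialDeriv eZ (fun z => swirl (u s) z ^ 2) y = 0 := by
    have e : (fun z => swirl (u s) z ^ 2) = fun _ => (0 : ℝ) := by
      funext z
      rw [hsw s hs z]
      ring
    rw [partialDeriv_apply, e]
    simp
  rw [hzero, mul_zero, timeDerivWithin_apply, derivWithin_of_isOpen hSo hs, convect_apply] at h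
  exact h

/-- **`θ = ω_θ/r` is conserved along confined off-axis trajectories of the cut-off flow.**  Let `(u, p)` be a classical Euler solution
with axisymmetric swirl-free slices on an open convex set of times `S ∋ t₁ ≤ t₀`, `χ` a bump about the origin and `φ` the flow of the
cut-off field `w = χ u` (part 1).  If the trajectory through an off-axis `x` at time `t₀` stays, during `[t₁, t₀]`, in the ball where
`χ = 1`, then `θ(t₁, φ(t₁,t₀,x)) = θ(t₀, x)`: along the trajectory `w = u`, the trajectory avoids the axis (part 1), so by the local
chain rule and `omegaTilde_transport` the composite has zero derivative on `[t₁, t₀]`.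
[cite: MajdaBertozziCUP2002, §2.3.3 (2.58)–(2.59) ("ξ is conserved along particle trajectories")] -/
theorem omegaTilde_evolutionMap_eq (hcl : IsClassicalEulerSolutionOn S 0 u p) (hSo : IsOpen S) (hS : Convex ℝ S)
    (hax : ∀ s ∈ S, IsAxisymmetric (u s)) (hsw : ∀ s ∈ S, HasNoSwirl (u s))
    (χ : ContDiffBump (0 : EuclideanSpace ℝ (Fin 3))) {t₁ t₀ : ℝ} (ht₁ : t₁ ∈ S) (ht₀ : t₀ ∈ S) (h10 : t₁ ≤ t₀)
    {x : EuclideanSpace ℝ (Fin 3)} (hx : cylRadius x ≠ 0)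
    (hconf : ∀ s ∈ Icc t₁ t₀, ODE.evolutionMap (fun t z => χ z • u t z) t₀ s x ∈ ball (0 : EuclideanSpace ℝ (Fin 3)) χ.rIn) :
    swirl (vorticity u t₁) (ODE.evolutionMap (fun t z => χ z • u t z) t₀ t₁ x) *
        (cylRadius (ODE.evolutionMap (fun t z => χ z • u t z) t₀ t₁ x) ^ 2)⁻¹ =
      swirl (vorticity u t₀) x * (cylRadius x ^ 2)⁻¹ := by
  have hu : IsSmoothSpaceTimeOn S u := hcl.smooth_velocity
  have hω : IsSmoothSpaceTimeOn S (vorticity u) := hu.isSmoothSpaceTimeOn_vorticity hSo.uniqueDiffOn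
  have hL := isUniformlyLipschitzOn_bump_smul χ hSo hu
  have haxisw : ∀ s ∈ S, ∀ z : EuclideanSpace ℝ (Fin 3), z 0 = 0 → z 1 = 0 →
      (fun t z => χ z • u t z) s z 0 = 0 ∧ (fun t z => χ z • u t z) s z 1 = 0 := by
    intro s hs z hz0 hz1
    have h := Wei2016.apply_zero_one_eq_zero_of_axis (hax s hs) hz0 hz1
    simp [h.1, h.2]
  set γ : ℝ → EuclideanSpace ℝ (Fin 3) := fun r => ODE.evolutionMap (fun t z => χ z • u t z) t₀ r x with hγ
  have hγoff : ∀ r ∈ S, cylRadius (γ r) ≠ 0 := fun r hr =>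
    cylRadius_evolutionMap_ne_zero hL hS haxisw ht₀ hr hx
  have hγder : ∀ r ∈ S, HasDerivAt γ ((fun t z => χ z • u t z) r (γ r)) r := fun r hr =>
    hL.hasDerivAt_evolutionMap hS ht₀ (hSo.mem_nhds hr) x
  have hIS : Icc t₁ t₀ ⊆ S := hS.ordConnected.out ht₁ ht₀
  -- the composite `g r = θ(r, γ r)` has zero derivative on `[t₁, t₀]`
  set g : ℝ → ℝ := fun r => swirl (vorticity u r) (γ r) * (cylRadius (γ r) ^ 2)⁻¹ with hg
  have hgder : ∀ r ∈ Icc t₁ t₀, HasDerivAt g 0 r := by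
    intro r hr
    have hrS : r ∈ S := hIS hr
    have hball := hconf r hr
    have hwu : (fun t z => χ z • u t z) r (γ r) = u r (γ r) := by
      show χ (γ r) • u r (γ r) = u r (γ r)
      rw [χ.one_of_mem_closedBall (ball_subset_closedBall hball), one_smul]
    have hdiff := differentiableAt_omegaTilde hω hSo hrS (hγoff r hrS)
    have h1 := hasDerivAt_uncurry_comp hdiff (hγder r hrS)
    have hpde := omegaTilde_transport hcl hSo hax hsw hrS (hγoff r hrS)
    rw [hwu] at h1
    exact h1.congr_deriv hpde
  have hgc : ContinuousOn g (Icc t₁ t₀) := fun r hr => (hgder r hr).continuousAt.continuousWithinAt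
  have hconst := constant_of_has_deriv_right_zero hgc fun r hr => (hgder r (Ico_subset_Icc_self hr)).hasDerivWithinAt
  have h := hconst t₀ (right_mem_Icc.2 h10)
  have hγ0 : γ t₀ = x := ODE.evolutionMap_self _ t₀ x
  simp only [hg, hγ0] at h
  exact h.symm

/-! ### The stub, unfolded -/

/-- **S2 `stub_materialConfinement` of the line `swirlfree-ledger`, signature unfolded** (`IsSwirlFreeDrifting u p`, `LedgerMonotone q u`,
`axisLedger v x = ‖curl v x‖ / cylRadius x` are the line's abbreviations): on the stratum of classical axisymmetric swirl-free Euler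
solutions on `(−∞, 0)` with sub-parabolic drift `‖u(τ,x)‖ ≤ M(−τ)^{−κ}`, `κ > 1/2`, the `q`-ledger (any `q > 0`) of a late ball `B(R₀)`
at time `t₀ < 0` is dominated by the `q`-ledger of `B(a)` at every `t₁ ∈ (−a², t₀)` once `a ≥ A₀`.  Proof: parts 1–2 as described in the
module docstring (localised flow, confinement `R₀ + K a^{2−2κ₀} ≤ a`, conservation of `ω_θ/r` along trajectories, axis null,
`det Dφ = 1`, change of variables). [cite: MajdaBertozziCUP2002, §2.3.3 (2.58)–(2.59), §1.3 Prop. 1.4] -/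
theorem materialConfinement_of_swirlFreeDrifting :
    ∀ (u : ℝ → EuclideanSpace ℝ (Fin 3) → EuclideanSpace ℝ (Fin 3)) (p : ℝ → EuclideanSpace ℝ (Fin 3) → ℝ),
      (IsClassicalEulerSolutionOn (Set.Iio 0) 0 u p ∧
          (∀ τ : ℝ, τ < 0 → IsAxisymmetric (u τ) ∧ HasNoSwirl (u τ)) ∧
          ∃ M κ : ℝ, 1 / 2 < κ ∧ ∀ τ : ℝ, τ < 0 → ∀ x : EuclideanSpace ℝ (Fin 3), ‖u τ x‖ ≤ M * (-τ) ^ (-κ)) →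
        ∀ q : ℝ, 0 < q →
          ∀ t₀ : ℝ, t₀ < 0 → ∀ R₀ : ℝ, 0 < R₀ → ∃ A₀ : ℝ, 0 < A₀ ∧ ∀ a : ℝ, A₀ ≤ a → ∀ t₁ ∈ Set.Ioo (-a ^ 2) t₀,
            ∫⁻ x in ball (0 : EuclideanSpace ℝ (Fin 3)) R₀, ENNReal.ofReal ((‖curl (u t₀) x‖ / cylRadius x) ^ q) ≤
              ∫⁻ x in ball (0 : EuclideanSpace ℝ (Fin 3)) a, ENNReal.ofReal ((‖curl (u t₁) x‖ / cylRadius x) ^ q) := by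
  intro u p hstr q _hq t₀ ht₀ R₀ hR₀
  obtain ⟨hcl, hsym, M, κ, hκ, hM⟩ := hstr
  -- reduced exponent `κ₀ = min κ ¾ ∈ (1/2, 1)` and constant `M₀`
  set τ₀ : ℝ := -t₀ with hτ₀
  have hτ₀0 : 0 < τ₀ := by rw [hτ₀]; linarith
  set κ₀ : ℝ := min κ (3 / 4) with hκ₀
  have hκ₀1 : κ₀ < 1 := lt_of_le_of_lt (min_le_right _ _) (by norm_num)
  have hκ₀h : 1 / 2 < κ₀ := lt_min hκ (by norm_num)
  have hκ₀κ : κ₀ ≤ κ := min_le_left _ _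
  set M₀ : ℝ := max M 0 * τ₀ ^ (κ₀ - κ) with hM₀
  have hM₀0 : 0 ≤ M₀ := mul_nonneg (le_max_right _ _) (Real.rpow_nonneg hτ₀0.le _)
  have hspeed_u : ∀ s : ℝ, s ≤ t₀ → ∀ y, ‖u s y‖ ≤ M₀ * (-s) ^ (-κ₀) := by
    intro s hs y
    have hs0 : s < 0 := by linarith
    have hns : 0 < -s := by linarith
    have hle : τ₀ ≤ -s := by rw [hτ₀]; linarith
    calc ‖u s y‖ ≤ M * (-s) ^ (-κ) := hM s hs0 y
      _ ≤ max M 0 * (-s) ^ (-κ) := mul_le_mul_of_nonneg_right (le_max_left _ _) (Real.rpow_nonneg hns.le _)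
      _ = max M 0 * ((-s) ^ (-κ₀) * (-s) ^ (κ₀ - κ)) := by
          rw [← Real.rpow_add hns]; congr 2; ring
      _ ≤ max M 0 * ((-s) ^ (-κ₀) * τ₀ ^ (κ₀ - κ)) := by
          apply mul_le_mul_of_nonneg_left _ (le_max_right _ _)
          apply mul_le_mul_of_nonneg_left _ (Real.rpow_nonneg hns.le _)
          exact Real.rpow_le_rpow_of_nonpos hτ₀0 hle (by linarith)
      _ = M₀ * (-s) ^ (-κ₀) := by rw [hM₀]; ring
  -- displacement scale `K a^β`, `β = 2 - 2κ₀ ∈ (0, 1)`, and the threshold `A₀`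
  set β : ℝ := 2 - 2 * κ₀ with hβ
  have hβ1 : 0 < 1 - β := by rw [hβ]; linarith
  set K : ℝ := M₀ / (1 - κ₀) with hK
  have hK0 : 0 ≤ K := div_nonneg hM₀0 (by linarith)
  set A₀ : ℝ := max (max (2 * R₀) ((2 * K + 1) ^ (1 / (1 - β)))) 1 with hA₀
  refine ⟨A₀, lt_of_lt_of_le one_pos (le_max_right _ _), fun a ha t₁ ht₁ => ?_⟩
  have ha1 : 1 ≤ a := le_trans (le_max_right _ _) ha
  have ha0 : 0 < a := by linarith
  have haR : 2 * R₀ ≤ a := le_trans (le_trans (le_max_left _ _) (le_max_left _ _)) ha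
  have haK : (2 * K + 1) ^ (1 / (1 - β)) ≤ a := le_trans (le_trans (le_max_right _ _) (le_max_left _ _)) ha
  have hKa : K * a ^ β ≤ a / 2 := by
    have hpow : 2 * K + 1 ≤ a ^ (1 - β) := by
      calc 2 * K + 1 = ((2 * K + 1) ^ (1 / (1 - β))) ^ (1 - β) := by
            rw [← Real.rpow_mul (by linarith), one_div_mul_cancel hβ1.ne', Real.rpow_one]
        _ ≤ a ^ (1 - β) := Real.rpow_le_rpow (by positivity) haK hβ1.le
    have haβ : 0 < a ^ β := Real.rpow_pos_of_pos ha0 β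
    have hsplit : a ^ (1 - β) * a ^ β = a := by
      rw [← Real.rpow_add ha0, show (1 - β) + β = 1 by ring, Real.rpow_one]
    have h2 : 2 * K * a ^ β ≤ a :=
      calc 2 * K * a ^ β ≤ (2 * K + 1) * a ^ β := by nlinarith [haβ]
        _ ≤ a ^ (1 - β) * a ^ β := mul_le_mul_of_nonneg_right hpow haβ.le
        _ = a := hsplit
    linarith
  set Rc : ℝ := R₀ + K * a ^ β with hRc
  have hRca : Rc ≤ a := by rw [hRc]; linarith
  have hRc0 : 0 < Rc := by rw [hRc]; have := mul_nonneg hK0 (Real.rpow_nonneg ha0.le β); linarith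
  -- the times
  have ht₁t₀ : t₁ < t₀ := ht₁.2
  have ht₁a : -a ^ 2 < t₁ := ht₁.1
  set T : Set ℝ := Set.Ioo (t₁ - 1) (t₀ / 2) with hT
  have hTo : IsOpen T := isOpen_Ioo
  have hTc : Convex ℝ T := convex_Ioo _ _
  have ht₀T : t₀ ∈ T := ⟨by linarith, by linarith⟩
  have ht₁T : t₁ ∈ T := ⟨by linarith, by linarith⟩
  have hTneg : T ⊆ Set.Iio 0 := fun s hs => lt_trans hs.2 (by linarith)
  have hclT : IsClassicalEulerSolutionOn T 0 u p := hcl.mono hTneg hTo.uniqueDiffOn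
  have hsymT : ∀ s ∈ T, IsAxisymmetric (u s) := fun s hs => (hsym s (hTneg hs)).1
  have hswT : ∀ s ∈ T, HasNoSwirl (u s) := fun s hs => (hsym s (hTneg hs)).2
  -- the cut-off flow
  set χ : ContDiffBump (0 : EuclideanSpace ℝ (Fin 3)) := ⟨Rc + 1, Rc + 2, by linarith, by linarith⟩ with hχ
  have hrIn : χ.rIn = Rc + 1 := rfl
  have hwsmooth : IsSmoothSpaceTimeOn T (fun t z => χ z • u t z) := isSmoothSpaceTimeOn_bump_smul χ hclT.smooth_velocity
  have hL : ODE.IsUniformlyLipschitzOn (fun t z => χ z • u t z) T := isUniformlyLipschitzOn_bump_smul χ hTo hclT.smooth_velocity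
  have hspeed : ∀ s ∈ Icc t₁ t₀, ∀ y, ‖(fun t z => χ z • u t z) s y‖ ≤ M₀ * (-s) ^ (-κ₀) := fun s hs y =>
    (norm_bump_smul_le χ (u s) y).trans (hspeed_u s hs.2 y)
  -- confinement of the parcels of `B(R₀)`
  have hconf : ∀ x ∈ ball (0 : EuclideanSpace ℝ (Fin 3)) R₀, ∀ s ∈ Icc t₁ t₀,
      ‖ODE.evolutionMap (fun t z => χ z • u t z) t₀ s x‖ < Rc := by
    intro x hx s hs
    have hd := norm_evolutionMap_sub_le hL hTc hTo ht₁T ht₀T ht₀ hκ₀1 hspeed x hs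
    have hns : 0 ≤ -s := by linarith [hs.2]
    have h1 : (-s) ^ (1 - κ₀) ≤ (a ^ 2) ^ (1 - κ₀) :=
      Real.rpow_le_rpow hns (by linarith [hs.1]) (by linarith)
    have h2 : (a ^ 2) ^ (1 - κ₀) = a ^ β := by
      rw [show a ^ 2 = a ^ (2 : ℝ) from (Real.rpow_two a).symm, ← Real.rpow_mul ha0.le]
      congr 1
      rw [hβ]; ring
    have h3 : M₀ / (1 - κ₀) * ((-s) ^ (1 - κ₀) - (-t₀) ^ (1 - κ₀)) ≤ K * a ^ β := by
      have h4 : 0 ≤ (-t₀) ^ (1 - κ₀) := Real.rpow_nonneg (by linarith) _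
      calc M₀ / (1 - κ₀) * ((-s) ^ (1 - κ₀) - (-t₀) ^ (1 - κ₀))
          ≤ M₀ / (1 - κ₀) * (-s) ^ (1 - κ₀) := by
            rw [← hK]; exact mul_le_mul_of_nonneg_left (by linarith) hK0
        _ ≤ K * a ^ β := by rw [← hK, ← h2]; exact mul_le_mul_of_nonneg_left h1 hK0
    calc ‖ODE.evolutionMap (fun t z => χ z • u t z) t₀ s x‖
        ≤ ‖x‖ + ‖ODE.evolutionMap (fun t z => χ z • u t z) t₀ s x - x‖ := norm_le_norm_add_norm_sub' _ _
      _ < R₀ + K * a ^ β := add_lt_add_of_lt_of_le (mem_ball_zero_iff.1 hx) (hd.trans h3)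
  have hconf_in : ∀ x ∈ ball (0 : EuclideanSpace ℝ (Fin 3)) R₀, ∀ s ∈ Icc t₁ t₀,
      ODE.evolutionMap (fun t z => χ z • u t z) t₀ s x ∈ ball (0 : EuclideanSpace ℝ (Fin 3)) χ.rIn := by
    intro x hx s hs
    rw [mem_ball_zero_iff, hrIn]
    linarith [hconf x hx s hs]
  -- the axis
  have haxisw : ∀ s ∈ T, ∀ z : EuclideanSpace ℝ (Fin 3), z 0 = 0 → z 1 = 0 →
      (fun t z => χ z • u t z) s z 0 = 0 ∧ (fun t z => χ z • u t z) s z 1 = 0 := by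
    intro s hs z hz0 hz1
    have h := Wei2016.apply_zero_one_eq_zero_of_axis (hsymT s hs) hz0 hz1
    simp [h.1, h.2]
  -- incompressibility along confined trajectories
  have hdet : ∀ x ∈ ball (0 : EuclideanSpace ℝ (Fin 3)) R₀,
      (fderiv ℝ (ODE.evolutionMap (fun t z => χ z • u t z) t₀ t₁) x).det = 1 := by
    intro x hx
    refine det_fderiv_evolutionMap_eq_one_of_divergence hL hwsmooth hTc hTo.uniqueDiffOn ht₀T ht₁T x fun s hs => ?_
    rw [uIcc_of_ge ht₁t₀.le] at hs
    have hsT : s ∈ T := hTc.ordConnected.out ht₁T ht₀T hs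
    have hball := hconf_in x hx s hs
    have h0 := hclT.divFree s hsT (ODE.evolutionMap (fun t z => χ z • u t z) t₀ s x)
    unfold VectorCalculus.divergence at h0 ⊢
    rwa [fderiv_bump_smul_eq χ (u s) hball]
  have hmaps : MapsTo (ODE.evolutionMap (fun t z => χ z • u t z) t₀ t₁)
      (ball (0 : EuclideanSpace ℝ (Fin 3)) R₀) (ball (0 : EuclideanSpace ℝ (Fin 3)) a) := fun x hx =>
    mem_ball_zero_iff.2 ((hconf x hx t₁ (left_mem_Icc.2 ht₁t₀.le)).trans_le hRca)
  have hcv := lintegral_comp_evolutionMap_le hL hwsmooth hTc hTo.uniqueDiffOn ht₀T ht₁T measurableSet_ball hdet hmaps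
    (fun y => ENNReal.ofReal ((‖curl (u t₁) y‖ / cylRadius y) ^ q))
  -- the a.e. identity of the densities (material conservation off the null axis)
  have hC2 : ∀ τ : ℝ, τ < 0 → ContDiff ℝ 2 (u τ) := fun τ hτ => (hcl.contDiff_velocity hτ).of_le (by norm_cast)
  have hax' : ∀ᵐ x ∂(volume : Measure (EuclideanSpace ℝ (Fin 3))), cylRadius x ≠ 0 := by
    rw [ae_iff]
    refine measure_mono_null (fun x hx => ?_) volume_setOf_cylRadius_eq_zero
    simpa using hx
  have hae : ∀ᵐ x ∂(volume.restrict (ball (0 : EuclideanSpace ℝ (Fin 3)) R₀)),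
      ENNReal.ofReal ((‖curl (u t₀) x‖ / cylRadius x) ^ q) =
        ENNReal.ofReal ((‖curl (u t₁) (ODE.evolutionMap (fun t z => χ z • u t z) t₀ t₁ x)‖ /
          cylRadius (ODE.evolutionMap (fun t z => χ z • u t z) t₀ t₁ x)) ^ q) := by
    filter_upwards [ae_restrict_mem measurableSet_ball, ae_restrict_of_ae hax'] with x hx hxoff
    have hΦoff : cylRadius (ODE.evolutionMap (fun t z => χ z • u t z) t₀ t₁ x) ≠ 0 :=
      cylRadius_evolutionMap_ne_zero hL hTc haxisw ht₀T ht₁T hxoff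
    have htr := omegaTilde_evolutionMap_eq hclT hTo hTc hsymT hswT χ ht₁T ht₀T ht₁t₀.le hxoff (hconf_in x hx)
    have e0 := div_cylRadius_eq_abs_omegaTilde (hsym t₀ ht₀).1 (hsym t₀ ht₀).2 (hC2 t₀ ht₀) hxoff
    have e1 := div_cylRadius_eq_abs_omegaTilde (hsym t₁ (lt_trans ht₁t₀ ht₀)).1 (hsym t₁ (lt_trans ht₁t₀ ht₀)).2
      (hC2 t₁ (lt_trans ht₁t₀ ht₀)) hΦoff
    rw [e0, e1]
    simp only [vorticity_apply] at htr
    rw [htr]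
  calc ∫⁻ x in ball (0 : EuclideanSpace ℝ (Fin 3)) R₀, ENNReal.ofReal ((‖curl (u t₀) x‖ / cylRadius x) ^ q)
      = ∫⁻ x in ball (0 : EuclideanSpace ℝ (Fin 3)) R₀,
          ENNReal.ofReal ((‖curl (u t₁) (ODE.evolutionMap (fun t z => χ z • u t z) t₀ t₁ x)‖ /
            cylRadius (ODE.evolutionMap (fun t z => χ z • u t z) t₀ t₁ x)) ^ q) := lintegral_congr_ae hae
    _ ≤ ∫⁻ y in ball (0 : EuclideanSpace ℝ (Fin 3)) a, ENNReal.ofReal ((‖curl (u t₁) y‖ / cylRadius y) ^ q) := hcv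

end Summit.NavierStokesRegularity.NavierStokesRegularity.Theorems.PowerGaugeEulerLiouville.SwirlfreeLedger

end
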